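import Summits.QuantumFields.YangMills.Theorems.UnitScaleTiltFluctuationComparisonRegPrGlobalSlackKernelCauchyEstimates
import Summits.QuantumFields.YangMills.Theorems.UnitScaleTiltFluctuationComparisonRegPrGlobalSlackCanonicalOnChiChiC
import HarnessLib

/-!
# `UnitScaleTiltFluctuationComparisonRegPrGlobalSlackKernelCauchyEstimatesOn` — THE SEVENTH-ORDER (σ = 7) TAYLOR ROW OF THE K1a CHART INTERFACE READ ON A
# SUB-PREDICATE OF THE WINDOW, AND (i*)χ FROM THE DISPLAYED-SHAPE CHART ROWS ON PRINT'S χ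
# (crux `FluctuationComparisonRegPrIntL`, stmt-QuantumFields-20520, skeleton v5kC STUB (i*)χ `stub_smallBlocksSlackOnChiAllChi`, odd `L ∈ {3,5}`; width seat ym-ust-20520-w2)

WHY.  Of the six chart rows the (i*)χ sockets read (`GlobalSlackCanonicalOnChi.K1aChartRowsOnChiKChi`, ★r1 g4 p577926), the remainder row `RemainderSmallΦOn χ` carries the
slack exponent `σ = 7` ([Balaban1985UV3] (57) p.270 «terms with an overall power greater than six»): it is the order-`≥ 7` Taylor rest of the charts at the chart
configurations, plus the far terms.  Lane A discharged its FULL-WINDOW form from the displayed analyticity G3D-01 (`remainderSmallΦ_taylorRest`, p531504) under the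
full-window configuration size row `CfgSizeΦ` — which is exactly the row that FAILS at `L ∈ {3,5}` on the window's edge band (cell FINDING #44/#56: the background
configuration of an edge datum leaves the chart's ball), and is why (i*)χ reads the three configuration rows only on print's χ-good data.  The Taylor estimate is
POINTWISE in the datum, so the restriction commutes with it:

* §1 `remainderSmallΦOn_add`, **`remainderSmallΦOn_taylorRest`**: `ChartAnalyticΦ ∧ Deriv1VanishΦ ∧ CfgSizeΦOn S` and the window `C_s·θ(n) ≤ ρ/4` ⟹
  `RemainderSmallΦOn S D (taylorRest Φ B) b₀ p₀ κ (2C_A(2C_s/ρ)⁷)` for BOTH runs; `remainderSmallΦOn_of_chartAnalytic` (+ the far row ON `S`).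
* §2 **`K1aDisplayedRowsOnChiKChi L μ 𝔠 a₀ a₁ a`** — the (i*)χ chart rows in the DISPLAYED shape: analyticity `ChartAnalyticΦ … 𝔠.κ ρ C_A` (G3D-01), no linear term
  `Deriv1VanishΦ` ((32)), the far row and the two configuration rows ON χ, K1a, and the Taylor structure row with the HONEST rest `taylorRest Φ B + Rfar`; NO kernel-size
  row and NO seventh-order row (both are now theorems); `k1aChartRowsOnChiCChi_of_displayedRowsOnChiKChi` (window from `γ ≤ gammaθ b₀ p₀ (ρ/(4·max 1 C_s))`), and
  **`smallBlocksSlackOnChiAllChi_of_displayedRowsOnChiKChi : … → ⟨(i*)χ TEXT VERBATIM⟩`** through ★r1 g4's `smallBlocksSlackOnChiAllChi_of_k1aChartRowsOnChiCChi`.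
After this file the (i*)χ line's independent chart rows are: G3D-01-shape analyticity and (32) for ONE chart family over both runs (displayed per run; two-run only
through the COMMON family — the recipe, F-g4-1), the far row ON χ (displayed `far_le` at the birth level), `CfgSizeΦOn χ`/`CfgCauchyΦOn χ` (19200-side, (27)/(M5)),
K1a `FlatKernelCauchyΦ` (the unprinted two-run number comparison) and the Taylor structure row at the old levels ((M1)).  Hypothesis schemas and their algebra only;
nothing of [Balaban1985UV3]/[King1986] is asserted; no numerics; registry untouched (`--supports stmt-QuantumFields-20520`).  YM₃ on the torus is a rung of the
ladder, not the Clay problem; nothing here is a claim about the crux or the gap.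

References: T. Bałaban, CMP 102 (1985) 255–275 [Balaban1985UV3] ((7) p.257, (25) p.262, (28)–(30) p.263, (32)–(34) p.264, (43)–(47) pp.266–267, (57) p.270);
C. King, CMP 102 (1986) 649–677 [King1986] (Thm 3.4 (3.9) p.656, Prop. 3.6 (3.55)–(3.56) p.662); S. B. Chae, Holomorphy and Calculus in Normed Spaces (1985) [Chae1985] (13.6).
-/

set_option autoImplicit false

noncomputable section

open scoped BigOperators
open Metric Set
open Literature.MathematicalPhysics.QuantumFieldTheory.Balaban1983to89
open Literature.MathematicalPhysics.QuantumFieldTheory.Balaban1983to89.T3ContinuumYM3Torus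
open Literature.MathematicalPhysics.QuantumFieldTheory.Balaban1983to89.T3UnitScaleTilt
open Literature.MathematicalPhysics.QuantumFieldTheory.Balaban1983to89.T3LevelShift
open Literature.MathematicalPhysics.QuantumFieldTheory.Balaban1983to89.T3AlphaInputsAC
open Literature.MathematicalPhysics.QuantumFieldTheory.Balaban1983to89.T3AlphaPolymerSocket
open Literature.MathematicalPhysics.QuantumFieldTheory.Balaban1983to89.T3AlphaInputsACTwoRun
open Literature.MathematicalPhysics.QuantumFieldTheory.Balaban1983to89.T3AlphaInputsACTwoRunLevel
open Literature.MathematicalPhysics.QuantumFieldTheory.Balaban1985CMP102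
open Literature.MathematicalPhysics.QuantumFieldTheory.Balaban1985CMP102.Setting
open Literature.MathematicalPhysics.QuantumFieldTheory.Balaban1985CMP102.Binders (ChartAnalyticityAsCited)
open Summit.QuantumFields.Balaban3D.Carriers
open Summit.QuantumFields.Balaban3D.Proofs.Primitives
open Summit.QuantumFields.Balaban3D.Proofs.GroupModelLieC (lieC)
open Summit.QuantumFields.Balaban3D.Proofs.Representation33 (jet26)
open Summit.QuantumFields.YangMills.Theorems
open Summit.QuantumFields.YangMills.Theorems.GlobalSlackKernelMatching
open Summit.QuantumFields.YangMills.Theorems.GlobalSlackCanonicalPolymers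
open Summit.QuantumFields.YangMills.Theorems.GlobalSlackCanonicalOnChi

namespace Summit.QuantumFields.YangMills.Theorems.GlobalSlackKernelMatchingOn

/-! ## §1 The seventh-order Taylor row on a sub-predicate of the window -/

section TaylorOn

variable {𝕍 : Type} [NormedAddCommGroup 𝕍] [NormedSpace ℂ 𝕍] {F : T3Family} {γ : ℝ}

/-- `RemainderSmallΦOn S` is additive in the rest (constants add). [folklore] -/
theorem remainderSmallΦOn_add (S : WinPred F) {D : AlphaDataT3 F γ} {R₁ R₂ : RemFam F} {b₀ p₀ κ C₁ C₂ : ℝ}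
    (h₁ : RemainderSmallΦOn S D R₁ b₀ p₀ κ C₁) (h₂ : RemainderSmallΦOn S D R₂ b₀ p₀ κ C₂) :
    RemainderSmallΦOn S D (R₁ + R₂) b₀ p₀ κ (C₁ + C₂) := by
  intro K n hn j hj V hV hS hS' Y hY
  obtain ⟨a₁, b₁⟩ := h₁ K n hn j hj V hV hS hS' Y hY
  obtain ⟨a₂, b₂⟩ := h₂ K n hn j hj V hV hS hS' Y hY
  simp only [Pi.add_apply]
  refine ⟨(abs_add_le _ _).trans ((add_le_add a₁ a₂).trans (le_of_eq (by ring))),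
    (abs_add_le _ _).trans ((add_le_add b₁ b₂).trans (le_of_eq (by ring)))⟩

/-- **THE SEVENTH-ORDER TAYLOR ROW ON `S` IS A THEOREM UNDER G3D-01 + (32) + THE CONFIGURATION SIZE ROW ON `S`**: for a finite-dimensional colour space,
`ChartAnalyticΦ D Φ κ ρ C_A`, `Deriv1VanishΦ Φ`, `CfgSizeΦOn S D B b₀ p₀ C_s` and the window `C_s·θ(n) ≤ ρ/4` give
`RemainderSmallΦOn S D (taylorRest Φ B) b₀ p₀ κ (2C_A(2C_s/ρ)⁷)` — (57) p.270 «terms with an overall power greater than six» for BOTH runs, at every window datum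
that is `S`-good for both runs (the estimate is pointwise in the datum: lane A's `abs_re_taylorRest_le` at the configuration the On-row bounds; run `K+1`'s
configuration is the transport of its pull-back, `transport_pullback`, and the transport does not increase the sup norm).  At `S :=` print's χ this is the
seventh-order row (i*)χ reads at `L ∈ {3,5}`, where the full-window `CfgSizeΦ` is not available (edge band). [cite: Balaban1985UV3, (28)–(30) p.263, (32) p.264, (47) p.267, (57) p.270] -/
theorem remainderSmallΦOn_taylorRest [FiniteDimensional ℂ 𝕍] (S : WinPred F) {D : AlphaDataT3 F γ} {Φ : ChartFam 𝕍 F} {B : CfgFam 𝕍 F}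
    {b₀ p₀ κ ρ C_A C_s : ℝ} (hCA : 0 ≤ C_A) (hCs : 0 ≤ C_s) (hρ : 0 < ρ) (hL : 1 ≤ (F.L : ℝ))
    (hθ0 : ∀ n, 0 ≤ θBal F.L γ b₀ p₀ n) (hwin : ∀ n, C_s * θBal F.L γ b₀ p₀ n ≤ ρ / 4)
    (hA : ChartAnalyticΦ D Φ κ ρ C_A) (h32 : Deriv1VanishΦ Φ) (hS : CfgSizeΦOn S D B b₀ p₀ C_s) :
    RemainderSmallΦOn S D (taylorRest Φ B) b₀ p₀ κ (2 * C_A * (2 * C_s / ρ) ^ 7) := by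
  intro K n hn j hj V hV hSV hSV' Y hY
  obtain ⟨hA0, hA1⟩ := hA K (K - n) j Y hY
  obtain ⟨hS0, hS1⟩ := hS K n hn j hj V hV hSV hSV' Y hY
  have hx0 : 0 ≤ ((F.L : ℝ) ^ (K - n - 1 - j))⁻¹ := by positivity
  have hx1 : ((F.L : ℝ) ^ (K - n - 1 - j))⁻¹ ≤ 1 := inv_le_one_of_one_le₀ (one_le_pow₀ hL)
  have hs0 : 0 ≤ C_s * θBal F.L γ b₀ p₀ n * (((F.L : ℝ) ^ (K - n - 1 - j))⁻¹) ^ 2 := by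
    have := hθ0 n; positivity
  have hsρ : C_s * θBal F.L γ b₀ p₀ n * (((F.L : ℝ) ^ (K - n - 1 - j))⁻¹) ^ 2 ≤ ρ / 4 :=
    (mul_le_of_le_one_right (mul_nonneg hCs (hθ0 n)) (pow_le_one₀ hx0 hx1)).trans (hwin n)
  have he : 0 ≤ Real.exp (-κ * D.treeLen K (1 + j) Y) := (Real.exp_pos _).le
  refine ⟨?_, ?_⟩
  · -- run `K`
    have key := abs_re_taylorRest_le hA0 (h32 K j Y) hs0 hsρ hS0
    exact key.trans (taylorRest_arith hCA hCs hρ he (hθ0 n) hx0 hx1)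
  · -- run `K+1`: its configuration is the transport of the pull-back, whose norm the On-row bounds
    set B₁ : PBond (F.P K) j → 𝕍 := fun c => B (K + 1) (K + 1 - n) (j + 1) (refineSet F K Y)
      (fieldShift (F.sitesPerDir_eq (m := F.m) (K := K + 1) (j := K + 1 - n) (m' := F.m) (K' := n) (j' := 0) (by omega)) V)
      (matchBond F K j c) with hB₁
    have hpull : B (K + 1) (K + 1 - n) (j + 1) (refineSet F K Y)
        (fieldShift (F.sitesPerDir_eq (m := F.m) (K := K + 1) (j := K + 1 - n) (m' := F.m) (K' := n) (j' := 0) (by omega)) V) =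
        transport 𝕍 F K j B₁ := (transport_pullback K j _).symm
    have hB' : ‖B (K + 1) (K + 1 - n) (j + 1) (refineSet F K Y)
        (fieldShift (F.sitesPerDir_eq (m := F.m) (K := K + 1) (j := K + 1 - n) (m' := F.m) (K' := n) (j' := 0) (by omega)) V)‖ ≤
        C_s * θBal F.L γ b₀ p₀ n * (((F.L : ℝ) ^ (K - n - 1 - j))⁻¹) ^ 2 := by
      rw [hpull]
      exact (norm_transport_le K j B₁).trans hS1
    have key := abs_re_taylorRest_le hA1 (h32 (K + 1) (j + 1) (refineSet F K Y)) hs0 hsρ hB'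
    exact key.trans (taylorRest_arith hCA hCs hρ he (hθ0 n) hx0 hx1)

/-- **THE FULL REMAINDER ROW ON `S` FROM THE DISPLAYED-SHAPE ROWS**: the Taylor rest ON `S` (above) plus a far-terms row ON `S`, `RemainderSmallΦOn S D Rfar b₀ p₀ κ C_f`
(the displayed G3D-06 `far_le` at the birth level — full window, hence on every `S` by `remainderSmallΦOn_of_full`; the `Rfar` of (M1) at the old levels), give
`RemainderSmallΦOn S D (taylorRest Φ B + Rfar) b₀ p₀ κ (2C_A(2C_s/ρ)⁷ + C_f)` — the rest of `taylorSplit_termOfCharts`. [cite: Balaban1985UV3, (57) p.270, p.264 L15-16, (47) p.267] -/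
theorem remainderSmallΦOn_of_chartAnalytic [FiniteDimensional ℂ 𝕍] (S : WinPred F) {D : AlphaDataT3 F γ} {Φ : ChartFam 𝕍 F} {B : CfgFam 𝕍 F}
    {Rfar : RemFam F} {b₀ p₀ κ ρ C_A C_s C_f : ℝ} (hCA : 0 ≤ C_A) (hCs : 0 ≤ C_s) (hρ : 0 < ρ) (hL : 1 ≤ (F.L : ℝ))
    (hθ0 : ∀ n, 0 ≤ θBal F.L γ b₀ p₀ n) (hwin : ∀ n, C_s * θBal F.L γ b₀ p₀ n ≤ ρ / 4)
    (hA : ChartAnalyticΦ D Φ κ ρ C_A) (h32 : Deriv1VanishΦ Φ) (hS : CfgSizeΦOn S D B b₀ p₀ C_s) (hfar : RemainderSmallΦOn S D Rfar b₀ p₀ κ C_f) :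
    RemainderSmallΦOn S D (taylorRest Φ B + Rfar) b₀ p₀ κ (2 * C_A * (2 * C_s / ρ) ^ 7 + C_f) :=
  remainderSmallΦOn_add S (remainderSmallΦOn_taylorRest S hCA hCs hρ hL hθ0 hwin hA h32 hS) hfar

/-- **THE WINDOW `C_s·θ(n) ≤ ρ/4` OF THE TAYLOR ROW FROM `γ` SMALL**: `γ ≤ gammaθ b₀ p₀ (ρ/(4·max 1 C_s))` gives it at every height (`T3Thresholds.θBal_le_of_le_gamma`).
[cite: Balaban1985UV3, (7) p.257, (28) p.263] -/
theorem window_taylor_le {L : ℕ} (hL : 1 ≤ L) {γ b₀ p₀ ρ C_s : ℝ} (hb : 0 < b₀) (hp : 0 < p₀) (hρ : 0 < ρ)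
    (hγ : 0 < γ) (hγ1 : γ ≤ 1) (hγw : γ ≤ gammaθ b₀ p₀ (ρ / (4 * max 1 C_s))) (n : ℕ) :
    C_s * θBal L γ b₀ p₀ n ≤ ρ / 4 := by
  have hm0 : 0 < max 1 C_s := lt_of_lt_of_le one_pos (le_max_left _ _)
  have hθ := T3Thresholds.θBal_le_of_le_gamma hL hb hp (σ := ρ / (4 * max 1 C_s)) (by positivity) hγ hγ1 hγw n
  have hθ0 : 0 ≤ θBal L γ b₀ p₀ n := (T3MinimiserStabilityReduction.θBal_pos hL hγ hγ1 hb p₀ n).le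
  calc C_s * θBal L γ b₀ p₀ n ≤ max 1 C_s * (ρ / (4 * max 1 C_s)) := mul_le_mul (le_max_right _ _) hθ hθ0 hm0.le
    _ = ρ / 4 := by field_simp

end TaylorOn

/-! ## §2 (i*)χ from the displayed-shape chart rows on print's χ -/

section Displayed

/-- **THE (i*)χ CHART ROWS IN THE DISPLAYED SHAPE, ON PRINT'S χ, NO LETTER ON THE RECORD** (hypothesis schema, never asserted): ★r1 g4's `K1aChartRowsOnChiKChi` with the
kernel-size row (34) and the seventh-order row (57) REPLACED by what the lane's step records display — analyticity `ChartAnalyticΦ … 𝔠.κ ρ C_A` (G3D-01 `chart`, both runs of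
ONE family), no linear term `Deriv1VanishΦ` ((32), the lane's `Eq32FromInvariance`), a far-terms row ON χ (G3D-06 `far_le`) — and the Taylor structure row with the HONEST rest
`taylorRest Φ B + Rfar` and vacuum constants `vacOf Φ` (so it reads «the term IS `Re Φ(B) + Rfar`»: the displayed `hPY`/`hPYZ` identity at the birth level, (M1) at the old
levels); K1a `FlatKernelCauchyΦ` and the two configuration rows ON χ (`CfgSizeΦOn`, `CfgCauchyΦOn (ℓ ≡ 1)`) VERBATIM; decay rate the record's `𝔠.κ`.
[cite: Balaban1985UV3, (25) p.262, (28)-(30) p.263, (32)-(33) p.264, (43)-(47) pp.266-267, (57) p.270; King1986, Thm 3.4 (3.9) p.656, Prop. 3.6 (3.56) p.662] -/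
def K1aDisplayedRowsOnChiKChi (L : ℕ) (μ : ℝ) (𝔠 : AlphaConsts L (suGroupModel 2).N) (a₀ a₁ a : ℝ) : Prop :=
  ∃ (ρ C_A C C_f C_s C_B γB : ℝ), 0 < ρ ∧ 0 ≤ C_A ∧ 0 ≤ C ∧ 0 ≤ C_f ∧ 0 ≤ C_s ∧ 0 ≤ C_B ∧ 0 < γB ∧
    ∀ (F : T3Family) (γ : ℝ) (hF : F.L = L) (hγ : 0 < γ), γ ≤ γB → ∀ (hγ1 : γ ≤ (min (hF ▸ 𝔠).gamma0 1) ^ 2),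
      AlphaInputsT3AC.OfV3ChiAt F (hF ▸ 𝔠) a₀ a₁ →
        ∃ (p : ∀ K, AlphaInputsT3AC.PkgAtV3Chi F (hF ▸ 𝔠) γ hγ hγ1 K), (∀ K, (p K).a₀ = a₀ ∧ (p K).a₁ = a₁) ∧
          ∀ ε₀ : ℝ, 0 < ε₀ → ε₀ ≤ a₀ →
          ∃ (Φ : ChartFam ↥(lieC (suGroupModel 2)) F) (B : CfgFam ↥(lieC (suGroupModel 2)) F) (Rfar : RemFam F),
            TaylorSplitΦ (canonPTCore fun K => (p K).toCore) Φ (vacOf Φ) B (taylorRest Φ B + Rfar) ∧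
            ChartAnalyticΦ (AlphaInputsT3AC.dataOfV3chi p (canonPolymerCore fun K => (p K).toCore)) Φ (hF ▸ 𝔠).κ ρ C_A ∧
            Deriv1VanishΦ Φ ∧
            FlatKernelCauchyΦ (AlphaInputsT3AC.dataOfV3chi p (canonPolymerCore fun K => (p K).toCore)) Φ (hF ▸ 𝔠).κ a C ∧
            RemainderSmallΦOn (fun K n h V => PrintChi.ChiGood F γ (hF ▸ 𝔠).b₀ (hF ▸ 𝔠).p₀ ε₀ μ (n := n) (K := K) h V)
              (AlphaInputsT3AC.dataOfV3chi p (canonPolymerCore fun K => (p K).toCore)) Rfar (hF ▸ 𝔠).b₀ (hF ▸ 𝔠).p₀ (hF ▸ 𝔠).κ C_f ∧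
            CfgSizeΦOn (fun K n h V => PrintChi.ChiGood F γ (hF ▸ 𝔠).b₀ (hF ▸ 𝔠).p₀ ε₀ μ (n := n) (K := K) h V)
              (AlphaInputsT3AC.dataOfV3chi p (canonPolymerCore fun K => (p K).toCore)) B (hF ▸ 𝔠).b₀ (hF ▸ 𝔠).p₀ C_s ∧
            CfgCauchyΦOn (fun K n h V => PrintChi.ChiGood F γ (hF ▸ 𝔠).b₀ (hF ▸ 𝔠).p₀ ε₀ μ (n := n) (K := K) h V)
              (AlphaInputsT3AC.dataOfV3chi p (canonPolymerCore fun K => (p K).toCore)) B (hF ▸ 𝔠).b₀ (hF ▸ 𝔠).p₀ a C_B fun _ => 1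

/-- **THE DISPLAYED-SHAPE ROWS GIVE ★r1 g4's LETTER-FREE On-χ CHART ROWS** `K1aChartRowsOnChiKChi` (same rate `a`): kernel size `C_E := C_A·(max 1 (12/ρ))⁶` by the operator-norm
Cauchy inequalities (`kernelSizeΦ_of_chartAnalytic`), seventh-order row ON χ with `C_R := 2C_A(2C_s/ρ)⁷ + C_f` by §1 under the window `C_s·θ(n) ≤ ρ/4`, which the shrunk threshold
`γB ⊓ gammaθ b₀ p₀ (ρ/(4·max 1 C_s))` supplies; vacuum constants `vacOf Φ`, rest `taylorRest Φ B + Rfar`. [cite: Balaban1985UV3, (7) p.257, (34) p.264, (57) p.270; King1986, Prop. 3.6 (3.55) p.662] -/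
theorem k1aChartRowsOnChiKChi_of_displayedRowsOnChiKChi {L : ℕ} {μ : ℝ} {𝔠 : AlphaConsts L (suGroupModel 2).N} {a₀ a₁ a : ℝ}
    (h : K1aDisplayedRowsOnChiKChi L μ 𝔠 a₀ a₁ a) : K1aChartRowsOnChiKChi L μ 𝔠 a₀ a₁ a := by
  obtain ⟨ρ, C_A, C, C_f, C_s, C_B, γB, hρ, hCA, hC, hCf, hCs, hCB, hγB, hall⟩ := h
  have hb := 𝔠.b₀_pos
  have hp := 𝔠.p₀_pos
  have hm0 : 0 < max 1 C_s := lt_of_lt_of_le one_pos (le_max_left _ _)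
  refine ⟨C, C_A * (max 1 (12 / ρ)) ^ 6, 2 * C_A * (2 * C_s / ρ) ^ 7 + C_f, C_s, C_B, min γB (gammaθ 𝔠.b₀ 𝔠.p₀ (ρ / (4 * max 1 C_s))),
    hC, by positivity, by positivity, hCs, hCB, lt_min hγB (gammaθ_pos hb hp (by positivity)), fun F γ hF hγ hγle hγ1 hOf => ?_⟩
  subst hF
  have hγB' : γ ≤ γB := hγle.trans (min_le_left _ _)
  have hγw : γ ≤ gammaθ 𝔠.b₀ 𝔠.p₀ (ρ / (4 * max 1 C_s)) := hγle.trans (min_le_right _ _)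
  have hγ1' : γ ≤ 1 := hγ1.trans (sq_min_one_le _ 𝔠.gamma0_pos)
  have hLn : 1 ≤ F.L := F.hL.2.le
  have hL1 : (1 : ℝ) ≤ (F.L : ℝ) := by exact_mod_cast hLn
  have hθ0 : ∀ n, 0 ≤ θBal F.L γ 𝔠.b₀ 𝔠.p₀ n := fun n => (T3MinimiserStabilityReduction.θBal_pos hLn hγ hγ1' hb 𝔠.p₀ n).le
  have hwin : ∀ n, C_s * θBal F.L γ 𝔠.b₀ 𝔠.p₀ n ≤ ρ / 4 := fun n => window_taylor_le hLn hb hp hρ hγ hγ1' hγw n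
  obtain ⟨p, hp', hrows⟩ := hall F γ rfl hγ hγB' hγ1 hOf
  refine ⟨p, hp', fun ε₀ hε hεa => ?_⟩
  obtain ⟨Φ, B, Rfar, hT, hA, h32, hK, hfar, hS, hBC⟩ := hrows ε₀ hε hεa
  exact ⟨Φ, vacOf Φ, B, taylorRest Φ B + Rfar, hT, hK, kernelSizeΦ_of_chartAnalytic hA,
    remainderSmallΦOn_of_chartAnalytic _ hCA hCs hρ hL1 hθ0 hwin hA h32 hS hfar, hS, hBC⟩

/-- **THE REGISTERED STUB (i*)χ FROM THE DISPLAYED-SHAPE CHART ROWS ON PRINT'S χ, BY NAME** (`GlobalSlackCanonicalOnChi.smallBlocksSlackOnChiAllChi_of_k1aChartRowsOnChiKChi ∘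
k1aChartRowsOnChiKChi_of_displayedRowsOnChiKChi`): if for every odd `1 < L < 7`, every margin `μ ∈ (0,1)`, every constants record and [7]-constants there is a rate exponent
`0 < a < 1` with `K1aDisplayedRowsOnChiKChi L μ 𝔠 a₀ a₁ a`, then the text of `stub_smallBlocksSlackOnChiAllChi` (skeleton v5kC of stmt-QuantumFields-20520, OWNER C3 pen
`birth_v5kC.lean` 3aa24e4fa8fcb956) holds VERBATIM — the kernel-size row (34) and the seventh-order row (57) are no longer inputs of the (i*)χ line.
[cite: Balaban1985UV3, (34) p.264, (47) p.267, (57) p.270; King1986, Thm 3.4 (3.9) p.656, Prop. 3.6 p.662] -/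
theorem smallBlocksSlackOnChiAllChi_of_displayedRowsOnChiKChi
    (h : ∀ (L : ℕ), Odd L → 1 < L → L < 7 → ∀ (μ : ℝ), 0 < μ → μ < 1 → ∀ (𝔠 : AlphaConsts L (suGroupModel 2).N) (a₀ a₁ : ℝ),
      0 < a₀ → 0 < a₁ → 𝔠.B₃ * a₁ ≤ a₀ → ∃ a : ℝ, 0 < a ∧ a < 1 ∧ K1aDisplayedRowsOnChiKChi L μ 𝔠 a₀ a₁ a) :
    ∀ (L : ℕ), Odd L → 1 < L → L < 7 → ∀ (μ : ℝ), 0 < μ → μ < 1 →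
      ∀ (𝔠 : Summit.QuantumFields.Balaban3D.Proofs.Primitives.AlphaConsts L (Summit.QuantumFields.Balaban3D.Carriers.suGroupModel 2).N)
        (a₀ a₁ : ℝ), 0 < a₀ → 0 < a₁ → 𝔠.B₃ * a₁ ≤ a₀ →
        ∃ a : ℝ, 0 < a ∧ ∃ γB : ℝ, 0 < γB ∧ ∀ (F : T3Family) (γ : ℝ) (hF : F.L = L) (hγ : 0 < γ), γ ≤ γB →
          ∀ (hγ1 : γ ≤ (min (hF ▸ 𝔠).gamma0 1) ^ 2),
            Summit.QuantumFields.YangMills.Theorems.AlphaInputsT3AC.OfV3ChiAt F (hF ▸ 𝔠) a₀ a₁ →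
            ∃ (p : ∀ K, Summit.QuantumFields.YangMills.Theorems.AlphaInputsT3AC.PkgAtV3Chi F (hF ▸ 𝔠) γ hγ hγ1 K),
              (∀ K, (p K).a₀ = a₀ ∧ (p K).a₁ = a₁) ∧
              ∃ (π : Summit.QuantumFields.YangMills.Theorems.AlphaInputsT3AC.PolymerT3 F) (σ : ℕ) (C : ℝ), 7 ≤ σ ∧ 0 ≤ C ∧
                ∀ ε₀ : ℝ, 0 < ε₀ → ε₀ ≤ a₀ →
                  Summit.QuantumFields.YangMills.Theorems.PrintChi.GlobalSupRateTSlackOn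
                    (fun K n h V => Summit.QuantumFields.YangMills.Theorems.PrintChi.ChiGood F γ (hF ▸ 𝔠).b₀ (hF ▸ 𝔠).p₀ ε₀ μ (n := n) (K := K) h V)
                    (Summit.QuantumFields.YangMills.Theorems.AlphaInputsT3AC.dataOfV3chi p π) (hF ▸ 𝔠).b₀ (hF ▸ 𝔠).p₀ a σ C :=
  smallBlocksSlackOnChiAllChi_of_k1aChartRowsOnChiKChi fun L hLo hL1 hL7 μ hμ0 hμ1 𝔠 a₀ a₁ ha0 ha1 hw => by
    obtain ⟨a, ha, ha1', hc⟩ := h L hLo hL1 hL7 μ hμ0 hμ1 𝔠 a₀ a₁ ha0 ha1 hw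
    exact ⟨a, ha, ha1', k1aChartRowsOnChiKChi_of_displayedRowsOnChiKChi hc⟩

end Displayed

end Summit.QuantumFields.YangMills.Theorems.GlobalSlackKernelMatchingOn

end
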